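import Mathlib.RingTheory.MvPolynomial.Homogeneous
import Mathlib.Algebra.MvPolynomial.Funext
import Mathlib.Algebra.Polynomial.Roots
import Mathlib.Algebra.CharZero.Infinite
import Mathlib.Topology.Algebra.MvPolynomial
import Mathlib.Topology.MetricSpace.Pseudo.Pi
import Mathlib.Topology.Instances.Real.Lemmas
import Mathlib.Order.Interval.Set.Infinite

/-!
# D1 (pinned family) — the ALGEBRA behind «the colour map is one real polynomial of total degree ≤ 4»: homogeneous components along rays, the ray law trims the degree, tensor Lagrange on the 5×5×5 grid, zero sets of nonzero polynomials have empty interior (pure Mathlib)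

Census row 81 of `HOME/g1/RESIDUE.md`, file 1 of 2 (the Mathlib-only half; its consumer is `Gaps/D1PinnedColourPolynomial`).  The node weights below are EXACTLY those of
`D1PinnedColourRayReadings.lim_ray_fourMembers` (four members `t = 0,1,2,3` of a colour ray; a quartic with NO linear term) and of `D1PinnedColourLineReadings.lim_line_fiveMembers`
(five members `t = 0,…,4` of an affine line; Lagrange), so that the pinned statements are one-line applications.

CONTENT (all [folklore], pure Mathlib; 0 def, 0 sorry): `eval_smul_of_isHomogeneous` (`φ(t•c) = tⁿ·φ(c)` for a homogeneous `φ`), `coeff_eq_zero_of_forall_sum_eq_zero`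
(a power sum vanishing for all real `t` has zero coefficients — `Polynomial.funext`), **`homogeneousComponent_eq_zero_of_rayLaw`** ∕ **`totalDegree_le_four_of_rayLaw`** (a real
polynomial in any set of variables obeying the four-node RAY LAW along every ray through the origin has NO homogeneous component of degree `1` or `≥ 5`:
`MvPolynomial.IsHomogeneous.eq_zero_of_forall_eval_eq_zero` over the infinite field ℝ), **`exists_mvPolynomial_of_lineLaw`** (TENSOR LAGRANGE: a function `ℝ → ℝ → ℝ → ℝ` obeying the
five-node LINE LAW along the three axis directions is `(x,y,z) ↦ MvPolynomial.eval ![x,y,z] P` for the interpolant of its `125` grid values), **`exists_mvPolynomial_deg_le_four`** (both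
laws ⟹ ONE `P` with `P.totalDegree ≤ 4`, `P.homogeneousComponent 1 = 0`, `P.coeff 0 = f 0 0 0`), `mvPolynomial_unique` (`MvPolynomial.funext`), **`interior_zeroSet_eq_empty`** (the real
zero set of a NONZERO polynomial in finitely many variables has EMPTY INTERIOR — `MvPolynomial.funext_set` on a small cube of infinite sides) and `isClosed_zeroSet`.

Provenance: cell pub-balaban-gaps, seat g1-p1 GEN 13 (prover-pub-balaban-gaps-g1-p1-g13-0), 2026-08-24.  HONEST FRAMING: [folklore] algebra, Mathlib BY NAME; NOTHING of Bałaban's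
asserted ([Balaban1987RG1] Thm 2 is UNPROVED IN PRINT); no coefficient of anything computed; binder (D1) of B12 Thm 2 NOT discharged; NOT `BetaPertH`, NOT continuum, NOT Clay.
-/

noncomputable section

open Finset
open scoped BigOperators

namespace Summit.QuantumFields.BalabanUV.Gaps.D1PinnedColourPolynomialAlgebra

/-! ## Homogeneous components along rays; the ray law trims the degree; tensor Lagrange on the grid -/

section Generic

open MvPolynomial


/-- [folklore] A homogeneous polynomial of degree `n` scales with `t ^ n` along rays: `φ(t•c) = tⁿ·φ(c)`. -/
theorem eval_smul_of_isHomogeneous {σ : Type*} {φ : MvPolynomial σ ℝ} {n : ℕ} (hφ : φ.IsHomogeneous n) (t : ℝ) (c : σ → ℝ) :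
    eval (t • c) φ = t ^ n * eval c φ := by
  rw [MvPolynomial.eval_eq, MvPolynomial.eval_eq, Finset.mul_sum]
  refine Finset.sum_congr rfl fun d hd => ?_
  have hdeg : n = ∑ i ∈ d.support, d i := hφ.degree_eq_sum_deg_support hd
  simp only [Pi.smul_apply, smul_eq_mul, mul_pow, Finset.prod_mul_distrib, Finset.prod_pow_eq_pow_sum, ← hdeg]
  ring

/-- [folklore] A finite power sum `Σ_{i<M} aᵢ tⁱ` vanishing for every real `t` has all coefficients zero. -/
theorem coeff_eq_zero_of_forall_sum_eq_zero {M : ℕ} {a : ℕ → ℝ} (h : ∀ t : ℝ, ∑ i ∈ range M, a i * t ^ i = 0) {i : ℕ} (hi : i < M) :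
    a i = 0 := by
  have hp : (∑ k ∈ range M, Polynomial.C (a k) * Polynomial.X ^ k : Polynomial ℝ) = 0 := by
    refine Polynomial.funext fun t => ?_
    simp only [Polynomial.eval_finsetSum, Polynomial.eval_mul, Polynomial.eval_C, Polynomial.eval_pow, Polynomial.eval_X,
      Polynomial.eval_zero]
    exact h t
  have hc := congrArg (fun p : Polynomial ℝ => p.coeff i) hp
  simp only [Polynomial.finsetSum_coeff, Polynomial.coeff_C_mul_X_pow, Polynomial.coeff_zero] at hc
  rw [Finset.sum_eq_single i (fun k _ hk => if_neg (Ne.symm hk)) (fun hi' => absurd (mem_range.mpr hi) hi')] at hc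
  simpa using hc

/-- [folklore] **THE RAY LAW TRIMS THE DEGREE.**  If a real polynomial `P` satisfies, along every ray `t ↦ t•c`, the four-node identity with the weights of
`D1PinnedColourRayReadings.lim_ray_fourMembers` (a quartic in `t` with NO linear term), then its homogeneous components of degree `1` and of every degree `≥ 5` vanish. -/
theorem homogeneousComponent_eq_zero_of_rayLaw {σ : Type*} (P : MvPolynomial σ ℝ)
    (hray : ∀ (c : σ → ℝ) (t : ℝ), eval (t • c) P =
      (1 - t ^ 2 * (t - 2) * (t - 3) / 2 + t ^ 2 * (t - 1) * (t - 3) / 4 - t ^ 2 * (t - 1) * (t - 2) / 18) * eval (0 : σ → ℝ) P +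
        t ^ 2 * (t - 2) * (t - 3) / 2 * eval c P + -(t ^ 2 * (t - 1) * (t - 3) / 4) * eval ((2 : ℝ) • c) P +
        t ^ 2 * (t - 1) * (t - 2) / 18 * eval ((3 : ℝ) • c) P)
    {k : ℕ} (hk : k = 1 ∨ 5 ≤ k) : P.homogeneousComponent k = 0 := by
  refine (homogeneousComponent_isHomogeneous k P).eq_zero_of_forall_eval_eq_zero fun c => ?_
  -- the values along the ray through `c`
  set E₀ := eval (0 : σ → ℝ) P
  set E₁ := eval c P
  set E₂ := eval ((2 : ℝ) • c) P
  set E₃ := eval ((3 : ℝ) • c) P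
  -- the quartic's coefficients, extended by zero
  let b : ℕ → ℝ := fun i =>
    if i = 0 then E₀ else if i = 2 then -(85 / 36) * E₀ + 3 * E₁ - 3 / 4 * E₂ + 1 / 9 * E₃
      else if i = 3 then 5 / 3 * E₀ - 5 / 2 * E₁ + E₂ - 1 / 6 * E₃ else if i = 4 then -(11 / 36) * E₀ + 1 / 2 * E₁ - 1 / 4 * E₂ + 1 / 18 * E₃ else 0
  set D := P.totalDegree
  -- `P(t•c) = Σ_{i ≤ D} tⁱ Hᵢ(c)`
  have hexp : ∀ t : ℝ, eval (t • c) P = ∑ i ∈ range (D + 1), eval c (P.homogeneousComponent i) * t ^ i := by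
    intro t
    have h1 : eval (t • c) P = eval (t • c) (∑ i ∈ range (D + 1), P.homogeneousComponent i) := by rw [sum_homogeneousComponent]
    rw [h1, map_sum]
    exact Finset.sum_congr rfl fun i _ => by rw [eval_smul_of_isHomogeneous (homogeneousComponent_isHomogeneous i P), mul_comm]
  -- both sides as power sums of length `D + 5`
  have hL : ∀ t : ℝ, ∑ i ∈ range (D + 5), eval c (P.homogeneousComponent i) * t ^ i = ∑ i ∈ range (D + 1), eval c (P.homogeneousComponent i) * t ^ i := by
    intro t
    rw [← Finset.sum_range_add_sum_Ico _ (show D + 1 ≤ D + 5 by omega), add_eq_left]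
    refine Finset.sum_eq_zero fun i hi => ?_
    rw [homogeneousComponent_eq_zero _ _ (by have := (Finset.mem_Ico.mp hi).1; omega), map_zero, zero_mul]
  have hR : ∀ t : ℝ, ∑ i ∈ range (D + 5), b i * t ^ i =
      (1 - t ^ 2 * (t - 2) * (t - 3) / 2 + t ^ 2 * (t - 1) * (t - 3) / 4 - t ^ 2 * (t - 1) * (t - 2) / 18) * E₀ +
        t ^ 2 * (t - 2) * (t - 3) / 2 * E₁ + -(t ^ 2 * (t - 1) * (t - 3) / 4) * E₂ + t ^ 2 * (t - 1) * (t - 2) / 18 * E₃ := by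
    intro t
    rw [← Finset.sum_range_add_sum_Ico _ (show 5 ≤ D + 5 by omega)]
    rw [Finset.sum_eq_zero (s := Ico 5 (D + 5)) fun i hi => by
      have h5 := (Finset.mem_Ico.mp hi).1
      simp only [b, if_neg (show i ≠ 0 by omega), if_neg (show i ≠ 2 by omega), if_neg (show i ≠ 3 by omega), if_neg (show i ≠ 4 by omega), zero_mul]]
    simp only [Finset.sum_range_succ, Finset.sum_range_zero, b]
    norm_num
    ring
  have hzero : ∀ t : ℝ, ∑ i ∈ range (D + 5), (eval c (P.homogeneousComponent i) - b i) * t ^ i = 0 := by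
    intro t
    simp only [sub_mul, Finset.sum_sub_distrib, hL, hR, ← hexp]
    rw [hray c t]; ring
  have hcoef : ∀ i, i < D + 5 → eval c (P.homogeneousComponent i) = b i :=
    fun i hi => sub_eq_zero.mp (coeff_eq_zero_of_forall_sum_eq_zero hzero hi)
  by_cases hkD : k < D + 5
  · rw [hcoef k hkD]
    rcases hk with rfl | hk5
    · simp [b]
    · simp only [b, if_neg (show k ≠ 0 by omega), if_neg (show k ≠ 2 by omega), if_neg (show k ≠ 3 by omega), if_neg (show k ≠ 4 by omega)]
  · rw [homogeneousComponent_eq_zero _ _ (by omega), map_zero]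

/-- [folklore] Under the ray law: `P` has total degree `≤ 4` and no linear part. -/
theorem totalDegree_le_four_of_rayLaw {σ : Type*} (P : MvPolynomial σ ℝ)
    (hray : ∀ (c : σ → ℝ) (t : ℝ), eval (t • c) P =
      (1 - t ^ 2 * (t - 2) * (t - 3) / 2 + t ^ 2 * (t - 1) * (t - 3) / 4 - t ^ 2 * (t - 1) * (t - 2) / 18) * eval (0 : σ → ℝ) P +
        t ^ 2 * (t - 2) * (t - 3) / 2 * eval c P + -(t ^ 2 * (t - 1) * (t - 3) / 4) * eval ((2 : ℝ) • c) P +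
        t ^ 2 * (t - 1) * (t - 2) / 18 * eval ((3 : ℝ) • c) P) :
    P.totalDegree ≤ 4 ∧ P.homogeneousComponent 1 = 0 := by
  refine ⟨Finset.sup_le fun d hd => ?_, homogeneousComponent_eq_zero_of_rayLaw P hray (Or.inl rfl)⟩
  by_contra hlt
  rw [not_le] at hlt
  have hdeg : d.degree = d.sum fun _ e => e := by rw [Finsupp.degree_apply]; rfl
  have h5 : 5 ≤ d.degree := by rw [hdeg]; omega
  have hz := homogeneousComponent_eq_zero_of_rayLaw P hray (Or.inr h5)
  have hc : coeff d (P.homogeneousComponent d.degree) = coeff d P := by rw [coeff_homogeneousComponent, if_pos rfl]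
  rw [hz, coeff_zero] at hc
  exact (mem_support_iff.mp hd) hc.symm

/-- [folklore] **TENSOR LAGRANGE ON THE `5×5×5` GRID.**  A real function of three real variables which, along every affine line `c⃗₀ + t·c⃗₁`, equals the five-node Lagrange
combination of its values at `t = 0,…,4` (the shape of `D1PinnedColourLineReadings.lim_line_fiveMembers`) is the evaluation of ONE real polynomial in three variables
(the tensor-product Lagrange interpolant of its `125` grid values `f i j k`, `i j k ∈ {0,…,4}`; only the three axis directions of the hypothesis are used). -/
theorem exists_mvPolynomial_of_lineLaw (f : ℝ → ℝ → ℝ → ℝ)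
    (hline : ∀ cE₀ cVH₀ cΛ₀ cE₁ cVH₁ cΛ₁ t : ℝ, f (cE₀ + t * cE₁) (cVH₀ + t * cVH₁) (cΛ₀ + t * cΛ₁) =
      (t - 1) * (t - 2) * (t - 3) * (t - 4) / 24 * f cE₀ cVH₀ cΛ₀ +
        -(t * (t - 2) * (t - 3) * (t - 4) / 6) * f (cE₀ + cE₁) (cVH₀ + cVH₁) (cΛ₀ + cΛ₁) +
        t * (t - 1) * (t - 3) * (t - 4) / 4 * f (cE₀ + 2 * cE₁) (cVH₀ + 2 * cVH₁) (cΛ₀ + 2 * cΛ₁) +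
        -(t * (t - 1) * (t - 2) * (t - 4) / 6) * f (cE₀ + 3 * cE₁) (cVH₀ + 3 * cVH₁) (cΛ₀ + 3 * cΛ₁) +
        t * (t - 1) * (t - 2) * (t - 3) / 24 * f (cE₀ + 4 * cE₁) (cVH₀ + 4 * cVH₁) (cΛ₀ + 4 * cΛ₁)) :
    ∃ P : MvPolynomial (Fin 3) ℝ, ∀ x y z : ℝ, f x y z = eval ![x, y, z] P := by
  -- the five Lagrange weights at the nodes `0,…,4`, as real functions and as polynomial expressions
  let lag : ℕ → ℝ → ℝ := fun n s =>
    if n = 0 then (s - 1) * (s - 2) * (s - 3) * (s - 4) / 24 else if n = 1 then -(s * (s - 2) * (s - 3) * (s - 4) / 6)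
      else if n = 2 then s * (s - 1) * (s - 3) * (s - 4) / 4 else if n = 3 then -(s * (s - 1) * (s - 2) * (s - 4) / 6) else s * (s - 1) * (s - 2) * (s - 3) / 24
  let Lag : ℕ → MvPolynomial (Fin 3) ℝ → MvPolynomial (Fin 3) ℝ := fun n Q =>
    if n = 0 then C (1 / 24) * ((Q - 1) * (Q - 2) * (Q - 3) * (Q - 4)) else if n = 1 then C (-1 / 6) * (Q * (Q - 2) * (Q - 3) * (Q - 4))
      else if n = 2 then C (1 / 4) * (Q * (Q - 1) * (Q - 3) * (Q - 4)) else if n = 3 then C (-1 / 6) * (Q * (Q - 1) * (Q - 2) * (Q - 4))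
      else C (1 / 24) * (Q * (Q - 1) * (Q - 2) * (Q - 3))
  have hLag : ∀ (n : ℕ) (Q : MvPolynomial (Fin 3) ℝ) (c : Fin 3 → ℝ), eval c (Lag n Q) = lag n (eval c Q) := by
    intro n Q c
    simp only [Lag, lag]
    split_ifs <;> simp only [map_mul, map_sub, eval_C, map_one, map_ofNat] <;> ring
  have sum5 : ∀ (g : ℕ → ℝ) (s : ℝ), ∑ k ∈ range 5, lag k s * g k =
      (s - 1) * (s - 2) * (s - 3) * (s - 4) / 24 * g 0 + -(s * (s - 2) * (s - 3) * (s - 4) / 6) * g 1 + s * (s - 1) * (s - 3) * (s - 4) / 4 * g 2 +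
        -(s * (s - 1) * (s - 2) * (s - 4) / 6) * g 3 + s * (s - 1) * (s - 2) * (s - 3) / 24 * g 4 := by
    intro g s
    simp only [Finset.sum_range_succ, Finset.sum_range_zero, lag, zero_add]
    norm_num
  -- the three axis passes of the line law, in sum form
  have hz : ∀ x y z : ℝ, f x y z = ∑ k ∈ range 5, lag k z * f x y k := fun x y z => by
    rw [sum5 (fun k : ℕ => f x y k)]; simpa using hline x y 0 0 0 1 z
  have hy : ∀ x y z : ℝ, f x y z = ∑ j ∈ range 5, lag j y * f x j z := fun x y z => by
    rw [sum5 (fun j : ℕ => f x j z)]; simpa using hline x 0 z 0 1 0 y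
  have hx : ∀ x y z : ℝ, f x y z = ∑ i ∈ range 5, lag i x * f i y z := fun x y z => by
    rw [sum5 (fun i : ℕ => f i y z)]; simpa using hline 0 y z 1 0 0 x
  refine ⟨∑ k ∈ range 5, ∑ j ∈ range 5, ∑ i ∈ range 5, C (f i j k) * (Lag i (X 0) * (Lag j (X 1) * Lag k (X 2))), fun x y z => ?_⟩
  have hev : ∀ i j k : ℕ, eval ![x, y, z] (C (f i j k) * (Lag i (X 0) * (Lag j (X 1) * Lag k (X 2)))) = f i j k * (lag i x * (lag j y * lag k z)) := by
    intro i j k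
    simp only [map_mul, eval_C, hLag, eval_X, Matrix.cons_val_zero, Matrix.cons_val_one, Matrix.cons_val_two, Matrix.head_cons, Matrix.tail_cons]
  simp only [map_sum, hev]
  calc f x y z = ∑ k ∈ range 5, lag k z * f x y k := hz x y z
    _ = ∑ k ∈ range 5, lag k z * ∑ j ∈ range 5, lag j y * ∑ i ∈ range 5, lag i x * f i j k :=
        Finset.sum_congr rfl fun k _ => by
          rw [hy x y k]
          exact congrArg _ (Finset.sum_congr rfl fun j _ => by rw [hx x j k])
    _ = ∑ k ∈ range 5, ∑ j ∈ range 5, ∑ i ∈ range 5, f i j k * (lag i x * (lag j y * lag k z)) := by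
        simp only [Finset.mul_sum]
        exact Finset.sum_congr rfl fun k _ => Finset.sum_congr rfl fun j _ => Finset.sum_congr rfl fun i _ => by ring

/-- [folklore] **LINE LAW + RAY LAW ⟹ ONE POLYNOMIAL OF TOTAL DEGREE ≤ 4 WITHOUT LINEAR PART.**  (The line law makes `f` a polynomial function; the ray law — a quartic with no
linear term along every ray through the colour-free member — kills the homogeneous components of degree `1` and `≥ 5`; the constant term is `f 0 0 0`.) -/
theorem exists_mvPolynomial_deg_le_four (f : ℝ → ℝ → ℝ → ℝ)
    (hline : ∀ cE₀ cVH₀ cΛ₀ cE₁ cVH₁ cΛ₁ t : ℝ, f (cE₀ + t * cE₁) (cVH₀ + t * cVH₁) (cΛ₀ + t * cΛ₁) =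
      (t - 1) * (t - 2) * (t - 3) * (t - 4) / 24 * f cE₀ cVH₀ cΛ₀ +
        -(t * (t - 2) * (t - 3) * (t - 4) / 6) * f (cE₀ + cE₁) (cVH₀ + cVH₁) (cΛ₀ + cΛ₁) +
        t * (t - 1) * (t - 3) * (t - 4) / 4 * f (cE₀ + 2 * cE₁) (cVH₀ + 2 * cVH₁) (cΛ₀ + 2 * cΛ₁) +
        -(t * (t - 1) * (t - 2) * (t - 4) / 6) * f (cE₀ + 3 * cE₁) (cVH₀ + 3 * cVH₁) (cΛ₀ + 3 * cΛ₁) +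
        t * (t - 1) * (t - 2) * (t - 3) / 24 * f (cE₀ + 4 * cE₁) (cVH₀ + 4 * cVH₁) (cΛ₀ + 4 * cΛ₁))
    (hray : ∀ cE cVH cΛ t : ℝ, f (t * cE) (t * cVH) (t * cΛ) =
      (1 - t ^ 2 * (t - 2) * (t - 3) / 2 + t ^ 2 * (t - 1) * (t - 3) / 4 - t ^ 2 * (t - 1) * (t - 2) / 18) * f 0 0 0 +
        t ^ 2 * (t - 2) * (t - 3) / 2 * f cE cVH cΛ + -(t ^ 2 * (t - 1) * (t - 3) / 4) * f (2 * cE) (2 * cVH) (2 * cΛ) +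
        t ^ 2 * (t - 1) * (t - 2) / 18 * f (3 * cE) (3 * cVH) (3 * cΛ)) :
    ∃ P : MvPolynomial (Fin 3) ℝ, P.totalDegree ≤ 4 ∧ P.homogeneousComponent 1 = 0 ∧ P.coeff 0 = f 0 0 0 ∧
      ∀ x y z : ℝ, f x y z = eval ![x, y, z] P := by
  obtain ⟨P, hP⟩ := exists_mvPolynomial_of_lineLaw f hline
  have hvec : ∀ c : Fin 3 → ℝ, eval c P = f (c 0) (c 1) (c 2) := by
    intro c
    have hc : c = ![c 0, c 1, c 2] := by ext i; fin_cases i <;> rfl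
    rw [hP, ← hc]
  have hray' : ∀ (c : Fin 3 → ℝ) (t : ℝ), eval (t • c) P =
      (1 - t ^ 2 * (t - 2) * (t - 3) / 2 + t ^ 2 * (t - 1) * (t - 3) / 4 - t ^ 2 * (t - 1) * (t - 2) / 18) * eval (0 : Fin 3 → ℝ) P +
        t ^ 2 * (t - 2) * (t - 3) / 2 * eval c P + -(t ^ 2 * (t - 1) * (t - 3) / 4) * eval ((2 : ℝ) • c) P +
        t ^ 2 * (t - 1) * (t - 2) / 18 * eval ((3 : ℝ) • c) P := by
    intro c t
    simp only [hvec, Pi.smul_apply, smul_eq_mul, Pi.zero_apply]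
    exact hray (c 0) (c 1) (c 2) t
  obtain ⟨h4, h1⟩ := totalDegree_le_four_of_rayLaw P hray'
  refine ⟨P, h4, h1, ?_, hP⟩
  have h0 := hvec 0
  simp only [Pi.zero_apply] at h0
  rw [← h0, MvPolynomial.eval_zero, MvPolynomial.constantCoeff_eq]


/-- [folklore] A real polynomial in three variables is determined by its values: uniqueness of the packaging below (`MvPolynomial.funext`, `ℝ` infinite). -/
theorem mvPolynomial_unique {P P' : MvPolynomial (Fin 3) ℝ} (h : ∀ x y z : ℝ, eval ![x, y, z] P = eval ![x, y, z] P') : P = P' :=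
  MvPolynomial.funext fun c => by
    have hc : c = ![c 0, c 1, c 2] := by ext i; fin_cases i <;> rfl
    rw [hc]; exact h _ _ _


/-! ## Zero sets of nonzero real polynomials: closed with empty interior -/

/-- [folklore] The real zero set of a polynomial in finitely many variables is closed (`MvPolynomial.continuous_eval`). -/
theorem isClosed_zeroSet {σ : Type*} [Fintype σ] (Q : MvPolynomial σ ℝ) : IsClosed {c : σ → ℝ | eval c Q = 0} :=
  isClosed_eq (MvPolynomial.continuous_eval Q) continuous_const

/-- [folklore] **THE REAL ZERO SET OF A NONZERO POLYNOMIAL HAS EMPTY INTERIOR** (finitely many variables): a ball of the sup metric is a cube with infinite sides, and a polynomial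
vanishing on such a cube is zero (`MvPolynomial.funext_set`). -/
theorem interior_zeroSet_eq_empty {σ : Type*} [Fintype σ] {Q : MvPolynomial σ ℝ} (hQ : Q ≠ 0) : interior {c : σ → ℝ | eval c Q = 0} = ∅ := by
  refine Set.eq_empty_iff_forall_notMem.mpr fun a ha => hQ ?_
  rw [mem_interior_iff_mem_nhds, Metric.mem_nhds_iff] at ha
  obtain ⟨ε, hε, hball⟩ := ha
  refine MvPolynomial.funext_set (fun i => Metric.ball (a i) ε) (fun i => ?_) fun x hx => ?_
  · rw [Real.ball_eq_Ioo]; exact Set.Ioo_infinite (by linarith)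
  · rw [map_zero]
    exact hball (by rw [ball_pi _ hε]; exact hx)

end Generic

end Summit.QuantumFields.BalabanUV.Gaps.D1PinnedColourPolynomialAlgebra

end
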